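import Literature.MathematicalPhysics.QuantumFieldTheory.Balaban1983to89.T4TwoLoopLaw
import HarnessLib

/-!
# `Balaban1983to89.TwoLoopLawH` — Bałaban's Theorem 2 of [I] at TWO-LOOP grade as ONE hypothesis SHAPE for a
# history-dependent β-function family, with the two-loop split (TL) stated ALONG BOX RUNS

Definition item `defn-TwoLoopLawH` (topic `Balaban1983to89`; filed by the owner of route `LuscherReduction`, cell
`ym-beyond`, for crux stmt-QuantumFields-20203, skeleton rev 3 «two-loop calibration»; SHARED with cell `pub-balaban`
T⁴ node U2 per director-ym ruling №133 Q4 — INTERFACE REQUEST [YMB-P1-G29-U2-1], `pub-balaban/INBOX.md`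
2026-08-27T15:29:40Z; no «U2 LITERAL: AMEND» was posted before the typer claimed the item, so the literal is the filed
one VERBATIM).  Elaborating local copy of record: `Stmt.twoLoopLawH` §0 of
`run/shared/lean/pub/ym-beyond/p1-g29-files/Lines-twolattice-r3.lean` (sha16 1a2ae9b1ae61a9c5).

CONTENT.  `TwoLoopLawH binf b1inf β` BUNDLES, for a history-dependent family `β : FlowStep.HBeta` (`β k (g_0,…,g_k)` =
Bałaban's `β_{k+1}`, recursion (0.20) `1/g_k² = 1/g_{k+1}² + β_{k+1}(g_0,…,g_k)`), exactly the binders of the run-level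
two-loop law `T4TwoLoopLaw.abs_invSq_bare_sub_twoLoop_le` (node U2, NE4): a printed-shape one-loop split
`S : B12Beta.OneLoopSplit β` (`β = β⁰ + β¹`, `β¹` vanishing at `g_k = 0`), constants `γ > 0` (the box `]0,γ]`), `b > 0`,
`C₁, c₀, C₃, c₁ ≥ 0`, `θ₀, θ₁ ∈ [0,1)`, a scale `k₀`, and the four laws
* `T4CouplingMatching.EventualLowerH b γ k₀ β` — `b ≤ β_{k+1}` on the boxes from scale `k₀` (discrete asymptotic freedom);
* (AF-0r) `|β⁰_{k+1} − binf| ≤ c₀θ₀^k` — the one-loop coefficients converge geometrically to the one-loop step `binf`;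
* (AF-1) `|β¹_{k+1}(p)| ≤ C₁·p_k` on the box `]0,γ]^{k+1}`;
* (TL) `|β¹_{k+1}(g_0,…,g_k) − b1inf·g_k²| ≤ C₃·g_k³ + c₁θ₁^k` for every RUN `gs` of (0.20) (`FlowStep.RGEqH K β gs`) that
  stays in the box, at every scale `k < K` — the two-loop split ALONG BOX RUNS.
DESIGN (the one choice, from the item): (TL) is NOT asked in the last variable on the whole box (the `hTL` of
`abs_invSq_bare_sub_twoLoop_le`): Bałaban's `β¹_{k+1}` carries history terms `~ p_k²·Σ_j θ^{k−j}p_j²` (irrelevant vertices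
born at earlier scales), `O(g_k⁴) ≤ γ·g_k³` along asymptotically-free runs but not `≤ C·p_k³` box-wide; the run-level law
still follows (§3).  UNITS are parameters: pub-balaban instantiates `binf := B12Normalization.stepBal 2 F.L`; LuscherReduction
`binf := stepBal 2 M = 8b₀ log M`, `b1inf := 32·b₁·log M` (SU(2), `1/g²_Bal = 4/g²_YM`).

HONEST FRAMING.  A hypothesis SHAPE (a `def … : Prop` with parameters — NOT a named fact: nothing is asserted of any
β-function, no `_holds` is owed; each consumer asserts it of ITS β on ITS route or takes it as a hypothesis).  Of Bałaban's
β-functions NOTHING here is printed beyond the SHAPE of the one-loop split ([Balaban1987RG1] (1.3), (1.6) pp. 260–261) and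
the two-sided linear envelope of Theorem 2 ([Balaban1987RG1] p. 259: "there exist constants β, β′, 0 < β ≦ β′, such that g_k
satisfy the inequality (0.31)" … "A proof of this theorem, based on perturbative calculations, will be given in a separate
paper, where more precise asymptotic behavior will be proved"; [Balaban1989LargeFieldII] p. 355: "The proof of Theorem 2,
which is based on second order perturbative calculations, […] has not been published yet").  `∃ β, TwoLoopLawH binf b1inf β`
is PROVABLE (§2, the Markov family) and `∀ β` is false — which is why the shared object is the predicate, not a closed Prop.
Not a statement about measures, continuum limits, infinite volume or the mass gap.

WHAT IS KERNEL-CHECKED (elementary real analysis over the named binders; nothing of it is a printed estimate): §1 the definition + `Iff.rfl` unfolding; §2 SANITY (1) `TwoLoopLawH.markov` — the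
two-loop MARKOV family `β_{k+1}(p) = binf + b1inf·p_k²` (`binf > 0`, `b1inf ≥ 0`) satisfies it with `γ = 1`, `b = binf`,
`C₁ = b1inf`, `c₀ = C₃ = c₁ = 0`, `k₀ = 0` (non-vacuity; after `T4TwoLoopLaw` §7) and `TwoLoopLawH.exists_markov`;
§3 SANITY (2) — `TwoLoopLawH.binf_pos` (the bundle forces `0 < b ≤ binf`), `abs_sum_beta1_sub_sq_le_of_run`
((TL)-along-runs summed: the run-level twin of `T4TwoLoopLaw.abs_sum_beta1_sub_sq_le`, whose proof only ever evaluated the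
box-wide (TL) at run prefixes), and `TwoLoopLawH.abs_invSq_bare_sub_twoLoop_le`: along every box run with `K > k₀` steps the
bundle yields EXACTLY the conclusion of `T4TwoLoopLaw.abs_invSq_bare_sub_twoLoop_le`
(`|1/(gs 0)² − 1/(gs K)² − Σ_{k<K} β⁰_k − (b1inf/binf)·log K| ≤ twoLoopConst … (1/(gs K)²)`), with the linear-term variant.

DECLARATIONS: 1 `def` (`TwoLoopLawH`) + 8 theorems; no `structure`, no `instance`, no `sorry`, no `axiom`.
-/

set_option autoImplicit false

noncomputable section

namespace Literature.MathematicalPhysics.QuantumFieldTheory.Balaban1983to89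

open Literature.MathematicalPhysics.QuantumFieldTheory.Balaban1983to89.FlowStep
open Literature.MathematicalPhysics.QuantumFieldTheory.Balaban1983to89.T4CouplingMatching
open Literature.MathematicalPhysics.QuantumFieldTheory.Balaban1983to89.T4OneLoopAsymptotics
open Literature.MathematicalPhysics.QuantumFieldTheory.Balaban1983to89.T4TwoLoopLaw
open Filter Finset
open _root_.Topology

/-! ## §1 The hypothesis shape -/

/-- **Bałaban's Theorem 2 of [I] at TWO-LOOP grade, as a hypothesis SHAPE** (units free: `binf` = the one-loop step,
`b1inf` = the two-loop step of the scheme) for a history-dependent β-function family `β` (`β k (g_0,…,g_k) = β_{k+1}`):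
there are a one-loop split `β = β⁰ + β¹` (`S : B12Beta.OneLoopSplit β`), a box `]0,γ]` (`γ > 0`), constants `b > 0`,
`C₁, c₀, C₃, c₁ ≥ 0`, rates `θ₀, θ₁ ∈ [0,1)` and a scale `k₀` with: the eventual lower bound `b ≤ β_{k+1}` on the boxes
from scale `k₀` (`EventualLowerH`); (AF-0r) `|β⁰_{k+1} − binf| ≤ c₀θ₀^k`; (AF-1) `|β¹_{k+1}(p)| ≤ C₁·p_k` on `]0,γ]^{k+1}`; and
the two-loop split (TL) `|β¹_{k+1}(g_0,…,g_k) − b1inf·g_k²| ≤ C₃g_k³ + c₁θ₁^k` ALONG EVERY RUN of (0.20)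
(`RGEqH K β gs`) that stays in the box, at every `k < K`.  The binders of `T4TwoLoopLaw.abs_invSq_bare_sub_twoLoop_le`
bundled, with (TL) along runs instead of box-wide in the last variable (history terms of Bałaban's `β¹` are `O(g_k⁴)`
along asymptotically-free runs, not `O(p_k³)` on the box).  The second-order computation behind Theorem 2 is NOT in print;
nothing is asserted here of any β-function. [cite: Balaban1987RG1, (0.20) p.256, Thm 2 p.259] [cite: Balaban1989LargeFieldII, p.355] -/
def TwoLoopLawH (binf b1inf : ℝ) (β : HBeta) : Prop :=
  ∃ S : B12Beta.OneLoopSplit β, ∃ (γ b C₁ c₀ θ₀ C₃ c₁ θ₁ : ℝ) (k₀ : ℕ),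
    0 < γ ∧ 0 < b ∧ 0 ≤ C₁ ∧ 0 ≤ c₀ ∧ 0 ≤ θ₀ ∧ θ₀ < 1 ∧ 0 ≤ C₃ ∧ 0 ≤ c₁ ∧ 0 ≤ θ₁ ∧ θ₁ < 1 ∧
    EventualLowerH b γ k₀ β ∧
    (∀ k : ℕ, |S.β0 k - binf| ≤ c₀ * θ₀ ^ k) ∧
    (∀ (k : ℕ) (p : Fin (k + 1) → ℝ), p ∈ Box γ k → |S.β1 k p| ≤ C₁ * p (Fin.last k)) ∧
    (∀ (K : ℕ) (gs : ℕ → ℝ), RGEqH K β gs → (∀ k, k ≤ K → 0 < gs k ∧ gs k ≤ γ) →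
      ∀ k, k < K → |S.β1 k (prefixOf gs k) - b1inf * gs k ^ 2| ≤ C₃ * gs k ^ 3 + c₁ * θ₁ ^ k)

namespace TwoLoopLawH

variable {binf b1inf : ℝ} {β : HBeta}

/-- Unfolding of `TwoLoopLawH` (by `Iff.rfl`): the bundled binders of Bałaban's Theorem 2 at two-loop grade.
[cite: Balaban1987RG1, (0.20) p.256, Thm 2 p.259] -/
theorem iff : TwoLoopLawH binf b1inf β ↔
    ∃ S : B12Beta.OneLoopSplit β, ∃ (γ b C₁ c₀ θ₀ C₃ c₁ θ₁ : ℝ) (k₀ : ℕ),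
      0 < γ ∧ 0 < b ∧ 0 ≤ C₁ ∧ 0 ≤ c₀ ∧ 0 ≤ θ₀ ∧ θ₀ < 1 ∧ 0 ≤ C₃ ∧ 0 ≤ c₁ ∧ 0 ≤ θ₁ ∧ θ₁ < 1 ∧
      EventualLowerH b γ k₀ β ∧
      (∀ k : ℕ, |S.β0 k - binf| ≤ c₀ * θ₀ ^ k) ∧
      (∀ (k : ℕ) (p : Fin (k + 1) → ℝ), p ∈ Box γ k → |S.β1 k p| ≤ C₁ * p (Fin.last k)) ∧
      (∀ (K : ℕ) (gs : ℕ → ℝ), RGEqH K β gs → (∀ k, k ≤ K → 0 < gs k ∧ gs k ≤ γ) →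
        ∀ k, k < K → |S.β1 k (prefixOf gs k) - b1inf * gs k ^ 2| ≤ C₃ * gs k ^ 3 + c₁ * θ₁ ^ k) :=
  Iff.rfl

/-! ## §2 Sanity (1): non-vacuity — the two-loop Markov family -/

/-- **The two-loop MARKOV family obeys the law**: `β_{k+1}(g_0,…,g_k) = binf + b1inf·g_k²` with `binf > 0`, `b1inf ≥ 0`
satisfies `TwoLoopLawH binf b1inf` with `γ = 1`, `b = binf`, `C₁ = b1inf`, `c₀ = C₃ = c₁ = 0`, `k₀ = 0` (the split
`β⁰ = binf`, `β¹ = b1inf·p_k²`).  After `T4TwoLoopLaw` §7; this is also why a CLOSED Prop `∃ β, TwoLoopLawH … β` would be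
vacuous — the law has content only when asserted of a DEFINED β-function or consumed as a hypothesis.  (The Markov family is
the two-loop truncation of the textbook flow `(d/ds)(1/g²) = −β(g)`, [Balaban1987RG1] p. 255 after (0.18); two-loop
coefficients [MontvayMunster1994] (5.66).) [cite: Balaban1987RG1, (0.18) p.255] [cite: MontvayMunster1994, (5.66) §5.1] -/
theorem markov (hbinf : 0 < binf) (hb1 : 0 ≤ b1inf) :
    TwoLoopLawH binf b1inf (fun k p => binf + b1inf * p (Fin.last k) ^ 2) := by
  set φ : HBeta := fun k p => binf + b1inf * p (Fin.last k) ^ 2 with hφ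
  let S : B12Beta.OneLoopSplit φ :=
    { β0 := fun _ => binf
      β1 := fun k p => b1inf * p (Fin.last k) ^ 2
      split := fun k p => rfl
      vanish := fun k p hp => by simp [hp] }
  refine ⟨S, 1, binf, b1inf, 0, 0, 0, 0, 0, 0, one_pos, hbinf, hb1, le_rfl, le_rfl, one_pos, le_rfl, le_rfl, le_rfl,
    one_pos, ?_, ?_, ?_, ?_⟩
  · intro k v _ _
    show binf ≤ binf + b1inf * v (Fin.last k) ^ 2
    nlinarith [sq_nonneg (v (Fin.last k))]
  · intro k
    show |binf - binf| ≤ 0 * (0 : ℝ) ^ k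
    simp
  · intro k p hp
    have h := (mem_box.1 hp) (Fin.last k)
    show |b1inf * p (Fin.last k) ^ 2| ≤ b1inf * p (Fin.last k)
    rw [abs_of_nonneg (by positivity)]
    nlinarith [mul_nonneg hb1 h.1.le, h.2]
  · intro K gs _ _ k _
    show |b1inf * (prefixOf gs k) (Fin.last k) ^ 2 - b1inf * gs k ^ 2| ≤ 0 * gs k ^ 3 + 0 * (0 : ℝ) ^ k
    simp [prefixOf]

/-- A family obeying `TwoLoopLawH binf b1inf` EXISTS whenever `binf > 0`, `b1inf ≥ 0` (the Markov family). [cite: Balaban1987RG1, (0.18) p.255] -/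
theorem exists_markov (hbinf : 0 < binf) (hb1 : 0 ≤ b1inf) : ∃ β : HBeta, TwoLoopLawH binf b1inf β :=
  ⟨_, markov hbinf hb1⟩

/-! ## §3 Sanity (2): along a box run the bundle yields the run-level two-loop law of `T4TwoLoopLaw` -/

/-- The bundle forces `b ≤ binf` for its lower-bound constant `b` — hence `0 < binf`: the one-loop step of a family obeying
the law is POSITIVE (`T4OneLoopAsymptotics.af_le_binf` on (AF-0r) ⇒ (AF-0), `Beta.LimitRate.tendsto_of_abs_sub_le_geometric`); Theorem 2's lower constant `β > 0` of (0.31).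
[cite: Balaban1987RG1, Thm 2 p.259] -/
theorem binf_pos (h : TwoLoopLawH binf b1inf β) : 0 < binf := by
  obtain ⟨S, γ, b, C₁, c₀, θ₀, C₃, c₁, θ₁, k₀, hγ, hb, -, -, hθ0, hθ1, -, -, -, -, hlo, hconv, hAF1, -⟩ := h
  exact hb.trans_le (af_le_binf S hγ hlo hAF1 (Beta.LimitRate.tendsto_of_abs_sub_le_geometric hθ0 hθ1 hconv))

/-- (TL) ALONG A RUN, SUMMED — the run-level twin of `T4TwoLoopLaw.abs_sum_beta1_sub_sq_le`: if
`|β¹_{k+1}(g_0,…,g_k) − b1inf·g_k²| ≤ C₃g_k³ + c₁θ₁^k` at every scale `k < K` of ONE run `gs`, then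
`|Σ_{k<K} β¹_{k+1}(g_0,…,g_k) − b1inf·Σ_{k<K} g_k²| ≤ C₃·Σ_{k<K} g_k³ + c₁/(1−θ₁)` (`c₁ ≥ 0`, `0 ≤ θ₁ < 1`).  (The box-wide
proof used (TL) only at the run's prefixes.) [cite: Balaban1987RG1, (0.20) p.256] -/
theorem abs_sum_beta1_sub_sq_le_of_run (S : B12Beta.OneLoopSplit β) {C₃ c₁ θ₁ : ℝ} {K : ℕ} {gs : ℕ → ℝ}
    (hc₁ : 0 ≤ c₁) (hθ₁0 : 0 ≤ θ₁) (hθ₁1 : θ₁ < 1)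
    (hTL : ∀ k, k < K → |S.β1 k (prefixOf gs k) - b1inf * gs k ^ 2| ≤ C₃ * gs k ^ 3 + c₁ * θ₁ ^ k) :
    |∑ k ∈ range K, S.β1 k (prefixOf gs k) - b1inf * ∑ k ∈ range K, (gs k) ^ 2| ≤
      C₃ * ∑ k ∈ range K, (gs k) ^ 3 + c₁ / (1 - θ₁) := by
  rw [mul_sum, ← sum_sub_distrib]
  refine (abs_sum_le_sum_abs _ _).trans ?_
  have hterm : ∀ k ∈ range K, |S.β1 k (prefixOf gs k) - b1inf * (gs k) ^ 2| ≤ C₃ * (gs k) ^ 3 + c₁ * θ₁ ^ k :=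
    fun k hk => hTL k (mem_range.1 hk)
  refine (sum_le_sum hterm).trans ?_
  rw [sum_add_distrib, ← mul_sum, ← mul_sum]
  have hg : ∑ k ∈ range K, θ₁ ^ k ≤ 1 / (1 - θ₁) := by
    have := geom_sum_Ico_le_of_lt_one hθ₁0 hθ₁1 (m := 0) (n := K)
    rw [range_eq_Ico]
    simpa using this
  have : c₁ * ∑ k ∈ range K, θ₁ ^ k ≤ c₁ / (1 - θ₁) :=
    calc c₁ * ∑ k ∈ range K, θ₁ ^ k ≤ c₁ * (1 / (1 - θ₁)) := mul_le_mul_of_nonneg_left hg hc₁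
      _ = c₁ / (1 - θ₁) := by ring
  linarith

/-- **THE RUN-LEVEL TWO-LOOP LAW FROM THE BUNDLE, with explicit constants** — the conclusion of
`T4TwoLoopLaw.abs_invSq_bare_sub_twoLoop_le` VERBATIM, from the same named binders except that (TL) is asked only along the
run in hand: along a solution `gs` of (0.20) in the box `]0,γ]` with `K > k₀` steps,
`|1/(gs 0)² − 1/(gs K)² − Σ_{k<K} β⁰_k − (b1inf/binf)·log K| ≤ twoLoopConst b binf γ C₁ c₀ θ₀ b1inf C₃ c₁ θ₁ k₀ (1/(gs K)²)`.
Same assembly as there (`invSq_bare_eq_split_sum`, `sum_run_cube_le`, `abs_sum_run_sq_sub_log_le` BY NAME), with §3's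
run-level sum in place of `abs_sum_beta1_sub_sq_le`. [cite: Balaban1987RG1, (0.18) p.255 and Thm 2 p.259] -/
theorem abs_invSq_bare_sub_twoLoop_le_of_run (S : B12Beta.OneLoopSplit β) {γ b C₁ c₀ θ₀ C₃ c₁ θ₁ : ℝ}
    {k₀ K : ℕ} {gs : ℕ → ℝ} (h : RGEqH K β gs) (hbox : ∀ k, k ≤ K → 0 < gs k ∧ gs k ≤ γ) (hb : 0 < b)
    (hlo : EventualLowerH b γ k₀ β) (hC₁ : 0 ≤ C₁)
    (hAF1 : ∀ k (p : Fin (k + 1) → ℝ), p ∈ Box γ k → |S.β1 k p| ≤ C₁ * p (Fin.last k))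
    (hθ0 : 0 ≤ θ₀) (hθ1 : θ₀ < 1) (hconv : ∀ k, |S.β0 k - binf| ≤ c₀ * θ₀ ^ k)
    (hC₃ : 0 ≤ C₃) (hc₁ : 0 ≤ c₁) (hθ₁0 : 0 ≤ θ₁) (hθ₁1 : θ₁ < 1)
    (hTL : ∀ k, k < K → |S.β1 k (prefixOf gs k) - b1inf * gs k ^ 2| ≤ C₃ * gs k ^ 3 + c₁ * θ₁ ^ k)
    (hK : k₀ < K) :
    |1 / (gs 0) ^ 2 - 1 / (gs K) ^ 2 - ∑ k ∈ range K, S.β0 k - b1inf / binf * Real.log K| ≤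
      twoLoopConst b binf γ C₁ c₀ θ₀ b1inf C₃ c₁ θ₁ k₀ (1 / (gs K) ^ 2) := by
  have hγ : 0 < γ := (hbox K le_rfl).1.trans_le (hbox K le_rfl).2
  have hbinf : 0 < binf :=
    hb.trans_le (af_le_binf S hγ hlo hAF1 (Beta.LimitRate.tendsto_of_abs_sub_le_geometric hθ0 hθ1 hconv))
  have e : 1 / (gs 0) ^ 2 - 1 / (gs K) ^ 2 - ∑ k ∈ range K, S.β0 k - b1inf / binf * Real.log K =
      (∑ k ∈ range K, S.β1 k (prefixOf gs k) - b1inf * ∑ k ∈ range K, (gs k) ^ 2) +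
        b1inf * (∑ k ∈ range K, (gs k) ^ 2 - 1 / binf * Real.log K) := by
    rw [invSq_bare_eq_split_sum S h]; ring
  rw [e]
  have h1 := abs_sum_beta1_sub_sq_le_of_run S hc₁ hθ₁0 hθ₁1 hTL (b1inf := b1inf)
  have h2 := sum_run_cube_le h hbox hb hlo hK.le
  have h3 := abs_sum_run_sq_sub_log_le S h hbox hb hlo hC₁ hAF1 hθ0 hθ1 hconv hbinf hK
  have h4 : |b1inf * (∑ k ∈ range K, (gs k) ^ 2 - 1 / binf * Real.log K)| ≤
      |b1inf| * profileConst b binf γ C₁ c₀ θ₀ k₀ (1 / (gs K) ^ 2) := by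
    rw [abs_mul]
    exact mul_le_mul_of_nonneg_left h3 (abs_nonneg _)
  have h5 : C₃ * ∑ k ∈ range K, (gs k) ^ 3 ≤ C₃ * ((k₀ : ℝ) * γ ^ 3 + 3 / (b * Real.sqrt b)) :=
    mul_le_mul_of_nonneg_left h2 hC₃
  unfold twoLoopConst
  linarith [abs_add_le (∑ k ∈ range K, S.β1 k (prefixOf gs k) - b1inf * ∑ k ∈ range K, (gs k) ^ 2)
    (b1inf * (∑ k ∈ range K, (gs k) ^ 2 - 1 / binf * Real.log K))]

/-- **SANITY (2): along every box run with `K > k₀` steps the bundle yields the conclusion of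
`T4TwoLoopLaw.abs_invSq_bare_sub_twoLoop_le`** — unpacked: a family obeying `TwoLoopLawH binf b1inf` has a split `S`, a box
size `γ > 0`, a scale `k₀` and an EXPLICIT envelope `Cst = twoLoopConst b binf γ C₁ c₀ θ₀ b1inf C₃ c₁ θ₁ k₀` (a function of
`P = 1/(gs K)²`, uniform in `K`) such that for every solution `gs` of (0.20) on `[0,K]` with `0 < gs k ≤ γ` and `k₀ < K`:
`|1/(gs 0)² − 1/(gs K)² − Σ_{k<K} β⁰_k − (b1inf/binf)·log K| ≤ Cst (1/(gs K)²)` — the bare inverse coupling is the sum of the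
one-loop coefficients plus the universal logarithm `(b1inf/binf)·log K` up to `O(1)`.
[cite: Balaban1987RG1, (0.18) p.255 and Thm 2 p.259] -/
theorem abs_invSq_bare_sub_twoLoop_le (h : TwoLoopLawH binf b1inf β) :
    ∃ (S : B12Beta.OneLoopSplit β) (γ : ℝ) (k₀ : ℕ) (Cst : ℝ → ℝ), 0 < γ ∧
      ∀ (K : ℕ) (gs : ℕ → ℝ), RGEqH K β gs → (∀ k, k ≤ K → 0 < gs k ∧ gs k ≤ γ) → k₀ < K →
        |1 / (gs 0) ^ 2 - 1 / (gs K) ^ 2 - ∑ k ∈ range K, S.β0 k - b1inf / binf * Real.log K| ≤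
          Cst (1 / (gs K) ^ 2) := by
  obtain ⟨S, γ, b, C₁, c₀, θ₀, C₃, c₁, θ₁, k₀, hγ, hb, hC₁, -, hθ0, hθ1, hC₃, hc₁, hθ₁0, hθ₁1, hlo, hconv, hAF1, hTL⟩ := h
  refine ⟨S, γ, k₀, twoLoopConst b binf γ C₁ c₀ θ₀ b1inf C₃ c₁ θ₁ k₀, hγ, ?_⟩
  intro K gs hrun hbox hK
  exact abs_invSq_bare_sub_twoLoop_le_of_run S hrun hbox hb hlo hC₁ hAF1 hθ0 hθ1 hconv hC₃ hc₁ hθ₁0 hθ₁1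
    (hTL K gs hrun hbox) hK

/-- The LINEAR-TERM variant along box runs (the conclusion of `T4TwoLoopLaw.abs_invSq_bare_sub_twoLoopLinear_le`):
`|1/(gs 0)² − 1/(gs K)² − K·binf − (b1inf/binf)·log K| ≤ Cst (1/(gs K)²)` for `K > k₀` — linear growth with the one-loop
step, then the universal logarithm, then `O(1)` uniform in `K`. [cite: Balaban1987RG1, (0.18) p.255 and Thm 2 p.259] -/
theorem abs_invSq_bare_sub_twoLoopLinear_le (h : TwoLoopLawH binf b1inf β) :
    ∃ (γ : ℝ) (k₀ : ℕ) (Cst : ℝ → ℝ), 0 < γ ∧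
      ∀ (K : ℕ) (gs : ℕ → ℝ), RGEqH K β gs → (∀ k, k ≤ K → 0 < gs k ∧ gs k ≤ γ) → k₀ < K →
        |1 / (gs 0) ^ 2 - 1 / (gs K) ^ 2 - (K : ℝ) * binf - b1inf / binf * Real.log K| ≤ Cst (1 / (gs K) ^ 2) := by
  obtain ⟨S, γ, b, C₁, c₀, θ₀, C₃, c₁, θ₁, k₀, hγ, hb, hC₁, -, hθ0, hθ1, hC₃, hc₁, hθ₁0, hθ₁1, hlo, hconv, hAF1, hTL⟩ := h
  refine ⟨γ, k₀, fun P => twoLoopConst b binf γ C₁ c₀ θ₀ b1inf C₃ c₁ θ₁ k₀ P + c₀ / (1 - θ₀), hγ, ?_⟩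
  intro K gs hrun hbox hK
  have h1 := abs_invSq_bare_sub_twoLoop_le_of_run S hrun hbox hb hlo hC₁ hAF1 hθ0 hθ1 hconv hC₃ hc₁ hθ₁0 hθ₁1
    (hTL K gs hrun hbox) hK
  have h2 := abs_sum_beta0_sub_linear_le S hθ0 hθ1 hconv K
  have e : 1 / (gs 0) ^ 2 - 1 / (gs K) ^ 2 - (K : ℝ) * binf - b1inf / binf * Real.log K =
      (1 / (gs 0) ^ 2 - 1 / (gs K) ^ 2 - ∑ k ∈ range K, S.β0 k - b1inf / binf * Real.log K) +
        (∑ k ∈ range K, S.β0 k - (K : ℝ) * binf) := by ring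
  rw [e]
  linarith [abs_add_le (1 / (gs 0) ^ 2 - 1 / (gs K) ^ 2 - ∑ k ∈ range K, S.β0 k - b1inf / binf * Real.log K)
    (∑ k ∈ range K, S.β0 k - (K : ℝ) * binf)]

end TwoLoopLawH

end Literature.MathematicalPhysics.QuantumFieldTheory.Balaban1983to89

end
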